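import Literature.Analysis.FluidPDE.HardSphereDynamicsProofs
import HarnessLib

/-!
# Conservation of the total momentum along hard-sphere trajectories and flows

Companion of `IsHardSphereTrajectory.configEnergy_eq_holds` (`HardSphereDynamicsProofs.lean`): on a
hard-sphere trajectory (`Literature.Analysis.FluidPDE.IsHardSphereTrajectory`) the total momentum
`configMomentum = ∑ᵢ vᵢ` is conserved — free flight does not change the velocities
(`configMomentum_freeFlight`) and an elastic collision preserves `∑ vᵢ` (`configMomentum_collidePair`);
as collision times are locally finite the momentum is a locally constant function of time, hence
constant. Consequence for the hypothesis structure `HardSphereFlow` (Alexander's theorem as data):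
`HardSphereFlow.configMomentum_flow`, the momentum is invariant along the flow on the good set.
All statements are theorems; no definition and no named fact is introduced.

## References

* I. Gallagher, L. Saint-Raymond, B. Texier, *From Newton to Boltzmann* (2013), §1.1, Prop. 4.1.1.
* C. Cercignani, R. Illner, M. Pulvirenti, *The Mathematical Theory of Dilute Gases* (1994), §4.2.
-/

open MeasureTheory Set Filter Topology

namespace Literature.Analysis.FluidPDE

section Momentum

variable {d : Type*} [Fintype d] {X : Type*} {N : ℕ}

omit [Fintype d] in
/-- The total momentum only depends on the velocities. [folklore] -/
theorem configMomentum_congr_snd {z z' : Config N d X} (h : ∀ i, (z i).2 = (z' i).2) :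
    configMomentum z = configMomentum z' := by
  simp only [configMomentum, h]

variable [TopologicalSpace X] {G : Geometry d X} {ε : ℝ} {γ : ℝ → Config N d X}

namespace IsHardSphereTrajectory

/-- On a hard-sphere trajectory the total momentum is constant to the right of every time.
[folklore] -/
theorem configMomentum_eq_of_mem_Ico (h : IsHardSphereTrajectory G ε N γ) {t u τ : ℝ}
    (hfree : ∀ σ ∈ Ioo t u, σ ∉ collisionTimes G ε γ) (hτ : τ ∈ Ico t u) :
    configMomentum (γ τ) = configMomentum (γ t) := by
  rw [h.eq_freeFlight_of_Ioo_free hfree hτ, configMomentum_freeFlight]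

/-- On a hard-sphere trajectory the total momentum is constant to the left of every time (an
elastic collision preserves `∑ v_i`, `configMomentum_collidePair`). [folklore] -/
theorem configMomentum_eq_of_Ioo_free (h : IsHardSphereTrajectory G ε N γ) {τ t : ℝ} (hτt : τ < t)
    (hfree : ∀ σ ∈ Ioo τ t, σ ∉ collisionTimes G ε γ) :
    configMomentum (γ t) = configMomentum (γ τ) := by
  by_cases ht : t ∈ collisionTimes G ε γ
  · obtain ⟨i, j, hij, hc⟩ := ht
    obtain ⟨-, zl, hzl, -, heq⟩ := h.binary t i j hij hc
    rw [heq, configMomentum_collidePair hij]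
    refine configMomentum_congr_snd fun k => ?_
    have h1 : Tendsto (fun σ => (γ σ k).2) (𝓝[<] t) (𝓝 (zl k).2) := by
      have hcont : Continuous fun z : Config N d X => (z k).2 := by fun_prop
      exact (hcont.tendsto zl).comp hzl
    have h2 : Tendsto (fun σ => (γ σ k).2) (𝓝[<] t) (𝓝 (γ τ k).2) := by
      refine tendsto_const_nhds.congr' ?_
      filter_upwards [Ioo_mem_nhdsLT hτt] with σ hσ
      rw [h.eq_freeFlight_of_Ioo_free hfree ⟨hσ.1.le, hσ.2⟩]
      rfl
    exact tendsto_nhds_unique h1 h2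
  · rw [h.free τ t hτt.le fun σ hσ => ?_, configMomentum_freeFlight]
    rcases hσ.2.eq_or_lt with rfl | hlt
    · exact ht
    · exact hfree σ ⟨hσ.1, hlt⟩

/-- The total momentum along a hard-sphere trajectory is locally constant in time. [folklore] -/
theorem isLocallyConstant_configMomentum (h : IsHardSphereTrajectory G ε N γ) :
    IsLocallyConstant fun t => configMomentum (γ t) := by
  refine (IsLocallyConstant.iff_eventually_eq _).2 fun t => ?_
  obtain ⟨s, hst, hfreel⟩ := h.exists_Ioo_left_free t
  obtain ⟨u, htu, hfreer⟩ := h.exists_Ioo_right_free t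
  filter_upwards [Ioo_mem_nhds hst htu] with y hy
  rcases lt_or_ge y t with hyt | hty
  · exact (h.configMomentum_eq_of_Ioo_free hyt fun σ hσ => hfreel σ ⟨hy.1.trans hσ.1, hσ.2⟩).symm
  · exact h.configMomentum_eq_of_mem_Ico hfreer ⟨hty, hy.2⟩

/-- **Conservation of the total momentum along a hard-sphere trajectory** (GST 2013 §1.1; CIP
1994 §4.2): free flight does not change the velocities and an elastic collision preserves `∑ v_i`;
the momentum is locally constant in time, hence constant. [folklore] -/
theorem configMomentum_eq (h : IsHardSphereTrajectory G ε N γ) (s t : ℝ) :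
    configMomentum (γ s) = configMomentum (γ t) :=
  h.isLocallyConstant_configMomentum.apply_eq_of_preconnectedSpace s t

end IsHardSphereTrajectory

/-- The total momentum is invariant along a hard-sphere flow on the good set. [folklore] -/
theorem HardSphereFlow.configMomentum_flow [MeasureSpace X] (Φ : HardSphereFlow G ε N)
    {z : Config N d X} (hz : z ∈ Φ.good) (t : ℝ) :
    configMomentum (Φ.flow t z) = configMomentum z := by
  have h := (Φ.isTrajectory z hz).configMomentum_eq t 0
  simpa [Φ.flow_zero z hz] using h

end Momentum

end Literature.Analysis.FluidPDE
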